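import Summits.HubbardSuperconductivity.HubbardSuperconductivity.Theorems.AnisotropyChordTransferFibre3FinGreenCell
import Summits.HubbardSuperconductivity.HubbardSuperconductivity.Theorems.AnisotropyChordTransferFibre3GroundExplicit

/-!
# Route `AnisotropyChord` / H0 rotor rung: FIN layer 1 — the explicit ground profile `groundF L λ` on a λ-CELL (kernel evaluator + soundness)

Second layer of the FIN evaluator (director ruling 2026-08-30 D2 route (b); LEVEL2-SPEC §2/§4).  p1 g24 made the ground two-magnon
profile an explicit function of `(L, λ₂)`: `Δ = deltaOfLam L λ₂`, `f = groundF L λ₂` (`…Fibre3DeltaOfLam`, `…Fibre3GroundExplicit`),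
built from the torus kernel `Gres`/`aKer` only.  Here those functions are enclosed, for EVERY `λ > 0` in a fixed-point cell
`λ·D ∈ [la, lb]`, by zero-data interval arithmetic on top of layer 0 (`…Fibre3FinGreenCell.GresCellIv`):
* the REGULARISED closed forms (no `1/λ`): with `G₀ = G̃_λ(0)`, `w = 1 − 1/V + λG₀`,
  `num = 4 − 4VλG₀`, `den = 4 + (V−1)λ − V(4−λ)λG₀`:
  `deltaOfLam = num/den` (`deltaOfLam_eq_reg`), `groundCs = Vλ/w` (`groundCs_eq_reg`), `deltaOfLam·groundFnn = num/(4w)`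
  (`delta_mul_fnn_eq_reg`) — smooth at `λ = 0`, so cells may start at `0⁺`;
* `wIv`, `csIv`, `dfnnIv`, `deltaIv`, ★ `groundFIv L la lb r₁ r₂` (computable, `Iv = ℤ × ℤ` at `D = 2^60`) and the CHECK
  `groundCellCheck L la lb` (layer-0 positivity + `lo w > 0`, `lo den > 0`);
* ★ `mem_groundF_cell`: `0 < λ`, `λ·D ∈ [la, lb]`, check ⇒ `groundF L λ (r₁,r₂) ∈ groundFIv L la lb r₁ r₂` for every `(r₁,r₂) ≠ 0`
  (`groundF = 0` at the origin), plus `mem_groundCs_cell`, `mem_deltaMulFnn_cell`, `mem_delta_cell`.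
With `ground_eq_explicit` / `ground_delta_eq` / `forall_ground_of_window_7` every «∀ ground profile» quantity at fixed `L` becomes a
finite family of such cell evaluations (next layers: `‖Π⁰‖²`, `⟨Π⁰,C0⟩` via `c0Explicit_holds`, `T⁺` via `sum_piR_C0fn`, `mHole`).
Prover seat `hubbard-h0-rotor-p3` g4; helper for stmt-HubbardSuperconductivity-23918 (piece A of rung 19089; `--supports`, helper class).
WHAT THIS IS NOT: nothing here proves superconductivity in the Hubbard model (rotor TARGET as worded stays FALSE, g15 verdict); it is
evaluator infrastructure for the FIN certificates of ONE conditional reduction. Tree imports only; no sorry, no axioms.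
-/

set_option linter.dupNamespace false
set_option autoImplicit false

namespace Summit.HubbardSuperconductivity.HubbardSuperconductivity.Theorems.AnisotropyChord.Transfer.Fibre3

namespace FinCell

open scoped BigOperators
open Finset Hole2

/-! ## Fixed-point helpers -/

/-- the exact interval of an integer constant `c`. [folklore] -/
def iconst (c : ℤ) : Iv := (c * D, c * D)

/-- scaling by a natural number. [folklore] -/
def iscale (n : ℕ) (I : Iv) : Iv := ((n : ℤ) * I.1, (n : ℤ) * I.2)

/-- the interval `[(V−1)/V]` of `1 − 1/V`, `V = L²` (outward rounded). [folklore] -/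
def oneSubInvV (L : ℕ) : Iv := idivn (iconst ((L : ℤ) * L - 1)) ((L : ℤ) * L)

/-! ## The cell evaluator of the regularised profile constants -/

/-- `G₀ = G̃_λ(0,0)` on the cell. [folklore] -/
def G0Iv (L : ℕ) (la lb : ℤ) : Iv := GresCellIv L la lb 0 0

/-- `w = 1 − 1/V + λ·G₀` on the cell. [folklore] -/
def wIv (L : ℕ) (la lb : ℤ) : Iv := iadd (oneSubInvV L) (imul (la, lb) (G0Iv L la lb))

/-- `c_s = V·λ / w` on the cell. [folklore] -/
def csIv (L : ℕ) (la lb : ℤ) : Iv := imul (iscale (L * L) (la, lb)) (iinv (wIv L la lb))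

/-- `num = 4 − 4V·λ·G₀` on the cell. [folklore] -/
def numIv (L : ℕ) (la lb : ℤ) : Iv := isub (iconst 4) (iscale (4 * (L * L)) (imul (la, lb) (G0Iv L la lb)))

/-- `den = 4 + (V−1)·λ − V·(4 − λ)·λ·G₀` on the cell. [folklore] -/
def denIv (L : ℕ) (la lb : ℤ) : Iv :=
  isub (iadd (iconst 4) (iscale (L * L - 1) (la, lb)))
    (iscale (L * L) (imul (imul (isub (iconst 4) (la, lb)) (la, lb)) (G0Iv L la lb)))

/-- `Δ·f_nn = num / (4w)` on the cell. [folklore] -/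
def dfnnIv (L : ℕ) (la lb : ℤ) : Iv := imul (numIv L la lb) (iinv (iscale 4 (wIv L la lb)))

/-- `Δ = num / den` on the cell. [folklore] -/
def deltaIv (L : ℕ) (la lb : ℤ) : Iv := imul (numIv L la lb) (iinv (denIv L la lb))

/-- ★ the ground profile `groundF L λ (r₁,r₂) = Δf_nn + c_s·(G₀ − G̃_λ(r))` on the cell (meant for `(r₁,r₂) ≠ 0`). [folklore] -/
def groundFIv (L : ℕ) (la lb : ℤ) (r1 r2 : ℕ) : Iv :=
  iadd (dfnnIv L la lb) (imul (csIv L la lb) (isub (G0Iv L la lb) (GresCellIv L la lb r1 r2)))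

/-- the cell check: layer-0 positivity, `lo w > 0`, `lo den > 0`. [folklore] -/
def groundCellCheck (L : ℕ) (la lb : ℤ) : Bool :=
  denCellPos L (cosTab L) la lb && decide (0 < (wIv L la lb).1) && decide (0 < (denIv L la lb).1)

/-! ## Soundness of the helpers -/

/-- an integer constant. [folklore] -/
theorem mem_iconst (c : ℤ) : mem (c : ℝ) (iconst c) := by
  have h := mem_exact (c * D)
  have e : (((c * D : ℤ)) : ℝ) / ((D : ℤ) : ℝ) = (c : ℝ) := by
    push_cast; exact mul_div_cancel_right₀ _ (ne_of_gt D_pos)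
  rw [e] at h
  exact h

/-- scaling by a natural number. [folklore] -/
theorem mem_iscale {x : ℝ} {I : Iv} (n : ℕ) (hx : mem x I) : mem ((n : ℝ) * x) (iscale n I) := by
  unfold mem iscale at *
  obtain ⟨h1, h2⟩ := hx
  have hn : (0 : ℝ) ≤ n := by positivity
  push_cast
  constructor <;> nlinarith

/-- `1 − 1/V ∈ oneSubInvV L`. [folklore] -/
theorem mem_oneSubInvV (L : ℕ) [NeZero L] : mem (1 - 1 / (L : ℝ) ^ 2) (oneSubInvV L) := by
  have hL : (0 : ℝ) < L := by exact_mod_cast Nat.pos_of_ne_zero (NeZero.ne L)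
  have hLL : (0 : ℤ) < (L : ℤ) * L := by
    have : (0 : ℤ) < L := by exact_mod_cast Nat.pos_of_ne_zero (NeZero.ne L)
    positivity
  have h := mem_idivn (mem_iconst ((L : ℤ) * L - 1)) hLL
  have e : ((((L : ℤ) * L - 1 : ℤ)) : ℝ) / ((((L : ℤ) * L : ℤ)) : ℝ) = 1 - 1 / (L : ℝ) ^ 2 := by
    push_cast; field_simp
  unfold oneSubInvV
  rw [e] at h
  exact h

/-! ## The regularised closed forms -/

variable (L : ℕ) [NeZero L]

/-- `V·λ·(original denominator of Δ) = den_reg` (`λ ≠ 0`). [folklore] -/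
theorem den_orig_mul_den {lam : ℝ} (hlam : lam ≠ 0) :
    (L : ℝ) ^ 2 * lam * (4 / ((L : ℝ) ^ 2 * lam) + 1 - 1 / (L : ℝ) ^ 2 - (4 - lam) * Gres L lam 0)
      = 4 + ((L : ℝ) ^ 2 - 1) * lam - (L : ℝ) ^ 2 * (4 - lam) * lam * Gres L lam 0 := by
  have hL0 : (L : ℝ) ≠ 0 := by exact_mod_cast (NeZero.ne L)
  have hVl : (L : ℝ) ^ 2 * lam ≠ 0 := mul_ne_zero (pow_ne_zero 2 hL0) hlam
  have e1 : (L : ℝ) ^ 2 * lam * (4 / ((L : ℝ) ^ 2 * lam)) = 4 := mul_div_cancel₀ _ hVl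
  have e2 : (L : ℝ) ^ 2 * lam * (1 / (L : ℝ) ^ 2) = lam := by
    rw [← mul_div_assoc, mul_one, mul_comm, mul_div_assoc, div_self (pow_ne_zero 2 hL0), mul_one]
  have : (L : ℝ) ^ 2 * lam * (4 / ((L : ℝ) ^ 2 * lam) + 1 - 1 / (L : ℝ) ^ 2 - (4 - lam) * Gres L lam 0)
      = (L : ℝ) ^ 2 * lam * (4 / ((L : ℝ) ^ 2 * lam)) + (L : ℝ) ^ 2 * lam
        - (L : ℝ) ^ 2 * lam * (1 / (L : ℝ) ^ 2) - (L : ℝ) ^ 2 * lam * ((4 - lam) * Gres L lam 0) := by ring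
  rw [this, e1, e2]
  ring

/-- `V·λ·(original numerator of Δ) = num_reg` (`λ ≠ 0`). [folklore] -/
theorem den_orig_mul_num {lam : ℝ} (hlam : lam ≠ 0) :
    (L : ℝ) ^ 2 * lam * (4 / ((L : ℝ) ^ 2 * lam) - 4 * Gres L lam 0)
      = 4 - 4 * (L : ℝ) ^ 2 * lam * Gres L lam 0 := by
  have hL0 : (L : ℝ) ≠ 0 := by exact_mod_cast (NeZero.ne L)
  have hVl : (L : ℝ) ^ 2 * lam ≠ 0 := mul_ne_zero (pow_ne_zero 2 hL0) hlam
  have e1 : (L : ℝ) ^ 2 * lam * (4 / ((L : ℝ) ^ 2 * lam)) = 4 := mul_div_cancel₀ _ hVl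
  rw [mul_sub, e1]
  ring

/-- `deltaOfLam L λ = (4 − 4VλG₀)/(4 + (V−1)λ − V(4−λ)λG₀)` for `λ ≠ 0`. [folklore] -/
theorem deltaOfLam_eq_reg {lam : ℝ} (hlam : lam ≠ 0) :
    deltaOfLam L lam
      = (4 - 4 * (L : ℝ) ^ 2 * lam * Gres L lam 0)
        / (4 + ((L : ℝ) ^ 2 - 1) * lam - (L : ℝ) ^ 2 * (4 - lam) * lam * Gres L lam 0) := by
  have hV : (0 : ℝ) < (L : ℝ) ^ 2 := by
    have : (0 : ℝ) < L := by exact_mod_cast Nat.pos_of_ne_zero (NeZero.ne L)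
    positivity
  have hVl : (L : ℝ) ^ 2 * lam ≠ 0 := mul_ne_zero hV.ne' hlam
  unfold deltaOfLam
  rw [← den_orig_mul_den L hlam, ← den_orig_mul_num L hlam, mul_div_mul_left _ _ hVl]

/-- the original denominator minus the original numerator is `w = 1 − 1/V + λG₀`. [folklore] -/
theorem den_sub_num_orig (lam : ℝ) :
    (4 / ((L : ℝ) ^ 2 * lam) + 1 - 1 / (L : ℝ) ^ 2 - (4 - lam) * Gres L lam 0)
      - (4 / ((L : ℝ) ^ 2 * lam) - 4 * Gres L lam 0) = 1 - 1 / (L : ℝ) ^ 2 + lam * Gres L lam 0 := by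
  ring

/-- `1 − deltaOfLam L λ = w / (original denominator)` when the original denominator is nonzero. [folklore] -/
theorem one_sub_deltaOfLam {lam : ℝ}
    (hDn : 4 / ((L : ℝ) ^ 2 * lam) + 1 - 1 / (L : ℝ) ^ 2 - (4 - lam) * Gres L lam 0 ≠ 0) :
    1 - deltaOfLam L lam
      = (1 - 1 / (L : ℝ) ^ 2 + lam * Gres L lam 0)
        / (4 / ((L : ℝ) ^ 2 * lam) + 1 - 1 / (L : ℝ) ^ 2 - (4 - lam) * Gres L lam 0) := by
  unfold deltaOfLam
  rw [one_sub_div hDn, den_sub_num_orig]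

/-- `groundCs L λ = Vλ/(1 − 1/V + λG₀)` (`λ ≠ 0`, original denominator and `w` nonzero). [folklore] -/
theorem groundCs_eq_reg {lam : ℝ} (hlam : lam ≠ 0)
    (hDn : 4 / ((L : ℝ) ^ 2 * lam) + 1 - 1 / (L : ℝ) ^ 2 - (4 - lam) * Gres L lam 0 ≠ 0)
    (hw : 1 - 1 / (L : ℝ) ^ 2 + lam * Gres L lam 0 ≠ 0) :
    groundCs L lam = (L : ℝ) ^ 2 * lam / (1 - 1 / (L : ℝ) ^ 2 + lam * Gres L lam 0) := by
  have hL0 : (L : ℝ) ≠ 0 := by exact_mod_cast (NeZero.ne L)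
  unfold groundCs groundFnn deltaOfLam
  set Dn : ℝ := 4 / ((L : ℝ) ^ 2 * lam) + 1 - 1 / (L : ℝ) ^ 2 - (4 - lam) * Gres L lam 0 with hDndef
  set Nn : ℝ := 4 / ((L : ℝ) ^ 2 * lam) - 4 * Gres L lam 0 with hNndef
  set w : ℝ := 1 - 1 / (L : ℝ) ^ 2 + lam * Gres L lam 0 with hwdef
  have hDN : Dn - Nn = w := by rw [hDndef, hNndef, hwdef]; ring
  have key : 4 * w + Nn * lam = 4 := by
    rw [hwdef, hNndef]
    field_simp
    ring
  rw [one_sub_div hDn, hDN]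
  have key2 : 4 * (w / Dn) + Nn / Dn * lam = 4 / Dn := by
    rw [eq_div_iff hDn]
    have : (4 * (w / Dn) + Nn / Dn * lam) * Dn = 4 * w + Nn * lam := by field_simp
    rw [this, key]
  rw [key2, eq_div_iff hw]
  field_simp

/-- `deltaOfLam L λ · groundFnn L λ = Vλ·(original numerator)/(4w)` (original denominator and `w` nonzero). [folklore] -/
theorem delta_mul_fnn_eq {lam : ℝ}
    (hDn : 4 / ((L : ℝ) ^ 2 * lam) + 1 - 1 / (L : ℝ) ^ 2 - (4 - lam) * Gres L lam 0 ≠ 0)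
    (hw : 1 - 1 / (L : ℝ) ^ 2 + lam * Gres L lam 0 ≠ 0) :
    deltaOfLam L lam * groundFnn L lam
      = (L : ℝ) ^ 2 * lam * (4 / ((L : ℝ) ^ 2 * lam) - 4 * Gres L lam 0)
        / (4 * (1 - 1 / (L : ℝ) ^ 2 + lam * Gres L lam 0)) := by
  unfold groundFnn
  rw [one_sub_deltaOfLam L hDn]
  unfold deltaOfLam
  set Dn : ℝ := 4 / ((L : ℝ) ^ 2 * lam) + 1 - 1 / (L : ℝ) ^ 2 - (4 - lam) * Gres L lam 0 with hDndef
  set Nn : ℝ := 4 / ((L : ℝ) ^ 2 * lam) - 4 * Gres L lam 0 with hNndef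
  set w : ℝ := 1 - 1 / (L : ℝ) ^ 2 + lam * Gres L lam 0 with hwdef
  field_simp

/-- `deltaOfLam L λ · groundFnn L λ = (4 − 4VλG₀)/(4w)` (`λ ≠ 0`, original denominator and `w` nonzero). [folklore] -/
theorem delta_mul_fnn_eq_reg {lam : ℝ} (hlam : lam ≠ 0)
    (hDn : 4 / ((L : ℝ) ^ 2 * lam) + 1 - 1 / (L : ℝ) ^ 2 - (4 - lam) * Gres L lam 0 ≠ 0)
    (hw : 1 - 1 / (L : ℝ) ^ 2 + lam * Gres L lam 0 ≠ 0) :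
    deltaOfLam L lam * groundFnn L lam
      = (4 - 4 * (L : ℝ) ^ 2 * lam * Gres L lam 0) / (4 * (1 - 1 / (L : ℝ) ^ 2 + lam * Gres L lam 0)) := by
  rw [delta_mul_fnn_eq L hDn hw, den_orig_mul_num L hlam]

/-- the original denominator from the regularised one: `VλDn = den_reg`, so `den_reg > 0`, `λ > 0` ⇒ `Dn > 0`. [folklore] -/
theorem den_orig_pos {lam : ℝ} (hlam : 0 < lam)
    (hden : 0 < 4 + ((L : ℝ) ^ 2 - 1) * lam - (L : ℝ) ^ 2 * (4 - lam) * lam * Gres L lam 0) :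
    0 < 4 / ((L : ℝ) ^ 2 * lam) + 1 - 1 / (L : ℝ) ^ 2 - (4 - lam) * Gres L lam 0 := by
  have hV : (0 : ℝ) < (L : ℝ) ^ 2 := by
    have : (0 : ℝ) < L := by exact_mod_cast Nat.pos_of_ne_zero (NeZero.ne L)
    positivity
  rw [← den_orig_mul_den L hlam.ne'] at hden
  exact pos_of_mul_pos_right hden (by positivity)

/-! ## Soundness of the cell evaluator -/

/-- the unpacked check. [folklore] -/
theorem groundCellCheck_spec {L : ℕ} {la lb : ℤ} (h : groundCellCheck L la lb = true) :
    denCellPos L (cosTab L) la lb = true ∧ 0 < (wIv L la lb).1 ∧ 0 < (denIv L la lb).1 := by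
  unfold groundCellCheck at h
  simp only [Bool.and_eq_true, decide_eq_true_eq] at h
  exact ⟨h.1.1, h.1.2, h.2⟩

/-- `λ ∈ (la, lb)` as a `mem` statement. [folklore] -/
theorem mem_lam {lam : ℝ} {la lb : ℤ} (hla : (la : ℝ) ≤ lam * ((D : ℤ) : ℝ)) (hlb : lam * ((D : ℤ) : ℝ) ≤ (lb : ℝ)) :
    mem lam (la, lb) := ⟨hla, hlb⟩

/-- `G₀` on the cell. [folklore] -/
theorem mem_G0_cell (hL : 3 ≤ L) {lam : ℝ} {la lb : ℤ}
    (hla : (la : ℝ) ≤ lam * ((D : ℤ) : ℝ)) (hlb : lam * ((D : ℤ) : ℝ) ≤ (lb : ℝ))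
    (hpos : denCellPos L (cosTab L) la lb = true) :
    mem (Gres L lam 0) (G0Iv L la lb) := by
  have h := mem_Gres_cell L hL hla hlb hpos (show 0 < L by omega) (show 0 < L by omega)
  have e : ((((0 : ℕ) : ZMod L), (((0 : ℕ) : ZMod L))) : Tor L) = 0 := by ext <;> simp
  rw [e] at h
  exact h

/-- `w` on the cell. [folklore] -/
theorem mem_w_cell (hL : 3 ≤ L) {lam : ℝ} {la lb : ℤ}
    (hla : (la : ℝ) ≤ lam * ((D : ℤ) : ℝ)) (hlb : lam * ((D : ℤ) : ℝ) ≤ (lb : ℝ))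
    (hpos : denCellPos L (cosTab L) la lb = true) :
    mem (1 - 1 / (L : ℝ) ^ 2 + lam * Gres L lam 0) (wIv L la lb) := by
  unfold wIv
  exact mem_iadd (mem_oneSubInvV L) (mem_imul (mem_lam hla hlb) (mem_G0_cell L hL hla hlb hpos))

/-- `num` on the cell. [folklore] -/
theorem mem_num_cell (hL : 3 ≤ L) {lam : ℝ} {la lb : ℤ}
    (hla : (la : ℝ) ≤ lam * ((D : ℤ) : ℝ)) (hlb : lam * ((D : ℤ) : ℝ) ≤ (lb : ℝ))
    (hpos : denCellPos L (cosTab L) la lb = true) :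
    mem (4 - 4 * (L : ℝ) ^ 2 * lam * Gres L lam 0) (numIv L la lb) := by
  unfold numIv
  have h := mem_isub (mem_iconst 4) (mem_iscale (4 * (L * L)) (mem_imul (mem_lam hla hlb) (mem_G0_cell L hL hla hlb hpos)))
  have e : ((4 : ℤ) : ℝ) - ((4 * (L * L) : ℕ) : ℝ) * (lam * Gres L lam 0) = 4 - 4 * (L : ℝ) ^ 2 * lam * Gres L lam 0 := by
    push_cast; ring
  rw [e] at h
  exact h

/-- `den` on the cell. [folklore] -/
theorem mem_den_cell (hL : 3 ≤ L) {lam : ℝ} {la lb : ℤ}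
    (hla : (la : ℝ) ≤ lam * ((D : ℤ) : ℝ)) (hlb : lam * ((D : ℤ) : ℝ) ≤ (lb : ℝ))
    (hpos : denCellPos L (cosTab L) la lb = true) :
    mem (4 + ((L : ℝ) ^ 2 - 1) * lam - (L : ℝ) ^ 2 * (4 - lam) * lam * Gres L lam 0) (denIv L la lb) := by
  unfold denIv
  have hLL : (1 : ℕ) ≤ L * L := by nlinarith
  have h := mem_isub (mem_iadd (mem_iconst 4) (mem_iscale (L * L - 1) (mem_lam hla hlb)))
    (mem_iscale (L * L) (mem_imul (mem_imul (mem_isub (mem_iconst 4) (mem_lam hla hlb)) (mem_lam hla hlb))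
      (mem_G0_cell L hL hla hlb hpos)))
  have e : ((4 : ℤ) : ℝ) + ((L * L - 1 : ℕ) : ℝ) * lam - ((L * L : ℕ) : ℝ) * ((((4 : ℤ) : ℝ) - lam) * lam * Gres L lam 0)
      = 4 + ((L : ℝ) ^ 2 - 1) * lam - (L : ℝ) ^ 2 * (4 - lam) * lam * Gres L lam 0 := by
    rw [Nat.cast_sub hLL]; push_cast; ring
  rw [e] at h
  exact h

/-- ★ `groundCs L λ ∈ csIv` on the cell (`0 < λ`, check). [folklore] -/
theorem mem_groundCs_cell (hL : 3 ≤ L) {lam : ℝ} (hlam : 0 < lam) {la lb : ℤ}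
    (hla : (la : ℝ) ≤ lam * ((D : ℤ) : ℝ)) (hlb : lam * ((D : ℤ) : ℝ) ≤ (lb : ℝ))
    (hchk : groundCellCheck L la lb = true) :
    mem (groundCs L lam) (csIv L la lb) := by
  obtain ⟨hpos, hw, hden⟩ := groundCellCheck_spec hchk
  have mw := mem_w_cell L hL hla hlb hpos
  have md := mem_den_cell L hL hla hlb hpos
  have hD := D_pos
  have hw' : 0 < 1 - 1 / (L : ℝ) ^ 2 + lam * Gres L lam 0 := by
    obtain ⟨h1, _⟩ := mw
    have : (0 : ℝ) < ((wIv L la lb).1 : ℝ) := by exact_mod_cast hw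
    nlinarith
  have hden' : 0 < 4 + ((L : ℝ) ^ 2 - 1) * lam - (L : ℝ) ^ 2 * (4 - lam) * lam * Gres L lam 0 := by
    obtain ⟨h1, _⟩ := md
    have : (0 : ℝ) < ((denIv L la lb).1 : ℝ) := by exact_mod_cast hden
    nlinarith
  rw [groundCs_eq_reg L hlam.ne' (den_orig_pos L hlam hden').ne' hw'.ne', div_eq_mul_one_div]
  unfold csIv
  have h := mem_imul (mem_iscale (L * L) (mem_lam hla hlb)) (mem_iinv mw hw)
  have e : ((L * L : ℕ) : ℝ) * lam = (L : ℝ) ^ 2 * lam := by push_cast; ring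
  rw [e] at h
  exact h

/-- ★ `deltaOfLam L λ · groundFnn L λ ∈ dfnnIv` on the cell (`0 < λ`, check). [folklore] -/
theorem mem_deltaMulFnn_cell (hL : 3 ≤ L) {lam : ℝ} (hlam : 0 < lam) {la lb : ℤ}
    (hla : (la : ℝ) ≤ lam * ((D : ℤ) : ℝ)) (hlb : lam * ((D : ℤ) : ℝ) ≤ (lb : ℝ))
    (hchk : groundCellCheck L la lb = true) :
    mem (deltaOfLam L lam * groundFnn L lam) (dfnnIv L la lb) := by
  obtain ⟨hpos, hw, hden⟩ := groundCellCheck_spec hchk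
  have mw := mem_w_cell L hL hla hlb hpos
  have md := mem_den_cell L hL hla hlb hpos
  have hD := D_pos
  have hw' : 0 < 1 - 1 / (L : ℝ) ^ 2 + lam * Gres L lam 0 := by
    obtain ⟨h1, _⟩ := mw
    have : (0 : ℝ) < ((wIv L la lb).1 : ℝ) := by exact_mod_cast hw
    nlinarith
  have hden' : 0 < 4 + ((L : ℝ) ^ 2 - 1) * lam - (L : ℝ) ^ 2 * (4 - lam) * lam * Gres L lam 0 := by
    obtain ⟨h1, _⟩ := md
    have : (0 : ℝ) < ((denIv L la lb).1 : ℝ) := by exact_mod_cast hden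
    nlinarith
  rw [delta_mul_fnn_eq_reg L hlam.ne' (den_orig_pos L hlam hden').ne' hw'.ne', div_eq_mul_one_div]
  unfold dfnnIv
  have h4w : mem (4 * (1 - 1 / (L : ℝ) ^ 2 + lam * Gres L lam 0)) (iscale 4 (wIv L la lb)) := by
    have := mem_iscale 4 mw; push_cast at this; exact this
  have h4pos : 0 < (iscale 4 (wIv L la lb)).1 := by unfold iscale; push_cast; linarith
  exact mem_imul (mem_num_cell L hL hla hlb hpos) (mem_iinv h4w h4pos)

/-- ★ `deltaOfLam L λ ∈ deltaIv` on the cell (`0 < λ`, check). [folklore] -/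
theorem mem_delta_cell (hL : 3 ≤ L) {lam : ℝ} (hlam : 0 < lam) {la lb : ℤ}
    (hla : (la : ℝ) ≤ lam * ((D : ℤ) : ℝ)) (hlb : lam * ((D : ℤ) : ℝ) ≤ (lb : ℝ))
    (hchk : groundCellCheck L la lb = true) :
    mem (deltaOfLam L lam) (deltaIv L la lb) := by
  obtain ⟨hpos, _, hden⟩ := groundCellCheck_spec hchk
  rw [deltaOfLam_eq_reg L hlam.ne', div_eq_mul_one_div]
  unfold deltaIv
  exact mem_imul (mem_num_cell L hL hla hlb hpos) (mem_iinv (mem_den_cell L hL hla hlb hpos) hden)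

/-- ★★ THE GROUND PROFILE ON A CELL: for `0 < λ` with `λ·D ∈ [la, lb]` and `groundCellCheck`, at every lattice point
`(r₁,r₂) ≠ 0` (`r₁, r₂ < L`), `groundF L λ (r₁,r₂) ∈ groundFIv L la lb r₁ r₂`. [folklore] -/
theorem mem_groundF_cell (hL : 3 ≤ L) {lam : ℝ} (hlam : 0 < lam) {la lb : ℤ}
    (hla : (la : ℝ) ≤ lam * ((D : ℤ) : ℝ)) (hlb : lam * ((D : ℤ) : ℝ) ≤ (lb : ℝ))
    (hchk : groundCellCheck L la lb = true) {r1 r2 : ℕ} (h1 : r1 < L) (h2 : r2 < L) (hr : ¬ (r1 = 0 ∧ r2 = 0)) :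
    mem (groundF L lam (((r1 : ℕ) : ZMod L), ((r2 : ℕ) : ZMod L))) (groundFIv L la lb r1 r2) := by
  obtain ⟨hpos, _, _⟩ := groundCellCheck_spec hchk
  have hne : ((((r1 : ℕ) : ZMod L), (((r2 : ℕ) : ZMod L))) : Tor L) ≠ 0 := by
    rw [Ne, Prod.mk_eq_zero, natCast_zmod_eq_zero L h1, natCast_zmod_eq_zero L h2]
    exact hr
  unfold groundF
  rw [if_neg hne]
  unfold groundFIv aKer
  exact mem_iadd (mem_deltaMulFnn_cell L hL hlam hla hlb hchk)
    (mem_imul (mem_groundCs_cell L hL hlam hla hlb hchk)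
      (mem_isub (mem_G0_cell L hL hla hlb hpos) (mem_Gres_cell L hL hla hlb hpos h1 h2)))

end FinCell

end Summit.HubbardSuperconductivity.HubbardSuperconductivity.Theorems.AnisotropyChord.Transfer.Fibre3
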